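import Mathlib
import Summits.Parity.BatemanHorn.Theses.GaussianFractions
-- (no import of Summits.Parity.BatemanHorn.Theses.IsogenyRedei: the farm snapshot is at rev ≤ 2 / incoherent
-- today; the crux is copied verbatim below as GaussianTailLargeCofactor')

/-!
# Sketch — crux-ideate stmt-Parity-14951 (GaussianTailLargeCofactor), ideator k = 1, round 1

Scratch declarations for the two idea cards (they must ELABORATE; nothing here is proved):

* `tailSum`, `fullTail`, `boundedCofactorSum`, `typeIHead` and the two bookkeeping identities
  `BiasLocalisation`, `FullTailVonMangoldt` (card `bias-localisation-merikoski-cut`, first lemma);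
  `ModulusSide` (divisor switch with the `E`-cutoff), `PowerWindow`, `SignedDeepCofactor`.
* `PowerChowlaDisc4`, `TwistedPowerChowlaSquares`, `deepPart`, `LevelRangeFromPower`,
  `WindowFromTwisted` (card `ss-shadow-power-chowla`, first lemma).
-/

open scoped BigOperators
open Filter Finset

namespace Summit.Parity.BatemanHorn.Cruxes.GaussianTailLargeCofactor.SketchK1

noncomputable section

/-- `μ(d) log d` as a real number. -/
def mulog (d : ℕ) : ℝ := (ArithmeticFunction.moebius d : ℝ) * Real.log (d : ℝ)

/-- ρ(d) = #{ν mod d : ν² ≡ −1}, via the tree's `polyRootCountMod` at `X² + 1`. -/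
def rho (d : ℕ) : ℕ :=
  Literature.NumberTheory.Sieve.polyRootCountMod ![(Polynomial.X ^ 2 + 1 : Polynomial ℤ)] d

/-- The crux's double sum `T_{η,E}(x) = Σ_{n≤x} Σ_{d ∣ n²+1, d > x^{1−η}, E·d < n²+1} μ(d) log d`
(character-for-character the summand of `IsogenyRedei.GaussianTailLargeCofactor`). -/
def tailSum (η : ℝ) (E x : ℕ) : ℝ :=
  ∑ n ∈ Icc 1 x, ∑ d ∈ Nat.divisors (n ^ 2 + 1),
    (if (x : ℝ) ^ (1 - η) < (d : ℝ) ∧ E * d < n ^ 2 + 1 then mulog d else 0)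

/-- VERBATIM copy of the ledger signature of stmt-Parity-14951 =
`Summit.Parity.BatemanHorn.Theses.IsogenyRedei.GaussianTailLargeCofactor` (rev 3, 2026-08-16); copied
here only because the farm snapshot used by `lean check` still carries IsogenyRedei rev ≤ 2 (the
rev-3 decls `PencilSelmerParitySW` / `SliceFrame` / `GaussianTailLargeCofactor` are "unknown
identifier" there). A crux-plan imports the route decl by name instead. -/
def GaussianTailLargeCofactor' : Prop :=
  ∃ η : ℝ, 0 < η ∧ η < 1 ∧ ∀ ε : ℝ, 0 < ε → ∃ E : ℕ, ∀ᶠ x : ℕ in Filter.atTop, |∑ n ∈ Finset.Icc 1 x, ∑ d ∈ Nat.divisors (n ^ 2 + 1), (if (x : ℝ) ^ (1 - η) < (d : ℝ) ∧ E * d < n ^ 2 + 1 then (ArithmeticFunction.moebius d : ℝ) * Real.log (d : ℝ) else 0)| ≤ ε * (x : ℝ)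

/-- The crux restated through `tailSum` (sanity: it is `Iff.rfl` up to unfolding `mulog`). -/
def CruxViaTailSum : Prop :=
  ∃ η : ℝ, 0 < η ∧ η < 1 ∧ ∀ ε : ℝ, 0 < ε → ∃ E : ℕ, ∀ᶠ x : ℕ in atTop, |tailSum η E x| ≤ ε * (x : ℝ)

example : CruxViaTailSum ↔ GaussianTailLargeCofactor' :=
  Iff.rfl

/-- The FULL Möbius tail of `n²+1` above `x^{1−η}` (no cofactor condition): the `k = 1`,
`f = X²+1` slice of `PolyMobiusTail`, i.e. `GaussianFractions.QuadraticMobiusTail`'s summand. -/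
def fullTail (η : ℝ) (x : ℕ) : ℝ :=
  ∑ n ∈ Icc 1 x, ∑ d ∈ Nat.divisors (n ^ 2 + 1), (if (x : ℝ) ^ (1 - η) < (d : ℝ) then mulog d else 0)

/-- The BOUNDED-COFACTOR sums `B_{η,E}(x) = Σ_{n≤x} Σ_{d ∣ n²+1, d > x^{1−η}, n²+1 ≤ E·d} μ(d) log d`
(cofactor `e = (n²+1)/d ≤ E`): the range route IsogenyRedei attacks via `PencilSelmerParitySW`. -/
def boundedCofactorSum (η : ℝ) (E x : ℕ) : ℝ :=
  ∑ n ∈ Icc 1 x, ∑ d ∈ Nat.divisors (n ^ 2 + 1),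
    (if (x : ℝ) ^ (1 - η) < (d : ℝ) ∧ n ^ 2 + 1 ≤ E * d then mulog d else 0)

/-- The Type-I head `Σ_{n≤x} Σ_{d ∣ n²+1, d ≤ x^{1−η}} μ(d) log d` (∼ −𝔖x by `TypeIMainTerm`, k = 1). -/
def typeIHead (η : ℝ) (x : ℕ) : ℝ :=
  ∑ n ∈ Icc 1 x, ∑ d ∈ Nat.divisors (n ^ 2 + 1), (if (d : ℝ) ≤ (x : ℝ) ^ (1 - η) then mulog d else 0)

/-- FIRST LEMMA of card `bias-localisation-merikoski-cut`, part (a) — pure finite-sum algebra: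
`T_{η,E} = FullTail_η − B_{η,E}` for all `η, E, x`. [provable now, M] -/
def BiasLocalisation : Prop :=
  ∀ (η : ℝ) (E x : ℕ), tailSum η E x = fullTail η x - boundedCofactorSum η E x

/-- Part (b): `FullTail_η(x) = −Σ_{n≤x} Λ(n²+1) − TypeIHead_η(x)` (Mathlib
`ArithmeticFunction.sum_moebius_mul_log_eq`: `Σ_{d∣m} μ(d) log d = −Λ(m)`). With `TypeIMainTerm`
(k = 1: TypeIHead ∼ −𝔖x, 𝔖 = `hardyLittlewoodEConst`) this is the BIAS-LOCALISATION reading of the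
crux: `T_{η,E}(x) = 𝔖x − Σ_{n≤x}Λ(n²+1) − B_{η,E}(x) + o(x)`. [provable now, M] -/
def FullTailVonMangoldt : Prop :=
  ∀ (η : ℝ) (x : ℕ), fullTail η x =
    -(∑ n ∈ Icc 1 x, (ArithmeticFunction.vonMangoldt (n ^ 2 + 1) : ℝ)) - typeIHead η x

/-- Part (c), the divisor switch WITH the `E`-cutoff (Finset.sum_comm + `d ≤ n²+1 ≤ x²+1`):
`T_{η,E}(x) = Σ_{d ≤ x²+1, d > x^{1−η}} μ(d) log d · #{n ≤ x : d ∣ n²+1, E·d < n²+1}` — the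
MODULUS-SIDE form: signed small-root counts, the cutoff landing at `d < (x²+1)/E`. [provable now, M] -/
def ModulusSide : Prop :=
  ∀ (η : ℝ) (E x : ℕ), tailSum η E x =
    ∑ d ∈ Icc (1 : ℕ) (x ^ 2 + 1), (if (x : ℝ) ^ (1 - η) < (d : ℝ) then
      mulog d * ((((Icc 1 x).filter (fun n : ℕ => d ∣ n ^ 2 + 1 ∧ E * d < n ^ 2 + 1)).card : ℕ) : ℝ)
      else 0)

/-- POWER WINDOW (card `bias-localisation-merikoski-cut`, stub 2; conjecture/theorem-candidate):
signed small-root Möbius on moduli `x(log x)^C < d ≤ x^{1+κ}` —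
`Σ_d μ(d) log d (#{n ≤ x : d ∣ n²+1} − xρ(d)/d) = o(x)`. For `κ < 0.195` this is inside the
range of Merikoski's proven Type-II (arXiv:1908.08816 Prop. 4) plus dlBD Type-I, modulo the missing
Type-I_j shapes (cards cofactor-multiset-sqrt-wall C1, modulus-side-one-bit-blind W4). -/
def PowerWindow (κ C : ℝ) : Prop :=
  (fun x : ℕ => ∑ d ∈ Icc 1 ⌊(x : ℝ) ^ (1 + κ)⌋₊,
      (if (x : ℝ) * Real.log x ^ C < (d : ℝ) then
        mulog d * (((((Icc 1 x).filter (fun n : ℕ => d ∣ n ^ 2 + 1)).card : ℕ) : ℝ) - (x : ℝ) * (rho d : ℝ) / d)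
        else 0))
    =o[atTop] fun x : ℕ => (x : ℝ)

/-- SIGNED DEEP COFACTOR (card `bias-localisation-merikoski-cut`, stub 3; the honest atom, WEAKER
than `GaussianFractions.CofactorLog`: signed over `e`, `e > E`, no sup): cofactors
`E < e ≤ x^{1−κ}` ⟺ moduli `d ≥ (n²+1)/x^{1−κ}`:
`∀ ε ∃ E: |Σ_{n≤x} Σ_{d ∣ n²+1, (n²+1) ≤ d·x^{1−κ}, E·d < n²+1} μ(d) log d| ≤ εx` eventually. -/
def SignedDeepCofactor (κ : ℝ) : Prop :=
  ∀ ε : ℝ, 0 < ε → ∃ E : ℕ, ∀ᶠ x : ℕ in atTop,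
    |∑ n ∈ Icc 1 x, ∑ d ∈ Nat.divisors (n ^ 2 + 1),
      (if ((n : ℝ) ^ 2 + 1) ≤ (d : ℝ) * (x : ℝ) ^ (1 - κ) ∧ E * d < n ^ 2 + 1 then mulog d else 0)|
      ≤ ε * (x : ℝ)

/-- Composition shape of card 2's line (to be PROVED by a crux-plan; here only typed):
lower window + power window + deep cofactor + main terms ⟹ the crux. `LogWindow`, `RootMainTerms`
are GaussianFractions' items (stmt-Parity-12220 / RootMainTerms), re-used by name. -/
def ModulusCutLine (κ C : ℝ) : Prop :=
  Summit.Parity.BatemanHorn.Theses.GaussianFractions.LogWindow →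
  Summit.Parity.BatemanHorn.Theses.GaussianFractions.RootMainTerms →
  PowerWindow κ C → SignedDeepCofactor κ →
  GaussianTailLargeCofactor'

/-! ### Card `ss-shadow-power-chowla`: the 𝔽_q[u] proof (Sawin–Shusterman §8) transplanted. -/

/-- Uniform power-saving Möbius cancellation along the disc `−4` family (the Γ-orbit of `X²+Y²`):
`g_{e,ν}(m) = e m² + 2ν m + c` with `ν² + 1 = e·c` — the cofactor polynomials of `n²+1` along the
root class `ν mod e`. ℤ-shadow of Sawin–Shusterman Thm 1.3 (arXiv:2008.09905) at `F = T² + 1`;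
coefficients allowed up to `y^A` (their "as large as any fixed power of X"). CONJECTURE-grade. -/
def PowerChowlaDisc4 : Prop :=
  ∃ α : ℝ, 0 < α ∧ ∀ A : ℝ, 0 < A → ∃ C : ℝ, ∀ (e ν c y : ℕ), 1 ≤ e → ν ^ 2 + 1 = e * c →
    (e : ℝ) ≤ (y : ℝ) ^ A →
      |∑ m ∈ Icc 1 y, (ArithmeticFunction.moebius (e * m ^ 2 + 2 * ν * m + c) : ℝ)| ≤ C * (y : ℝ) ^ (1 - α)

/-- Kloosterman-twisted power-saving Möbius cancellation along `X² + s²`: for `1 ≤ s ≤ R²`,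
`0 < |h| ≤ R^θ` (a SMALL POWER of harmonics — the window is cut at a power `x^{1+κ}`, exactly as
Sawin–Shusterman cut theirs at degree `(1+ε)d`): `|Σ_{r ≤ R, (r,s)=1} μ(r²+s²) e(h r̄/s)| ≤ C R^{1−α}`
(`r̄ r ≡ 1 mod s`). ℤ-shadow of SS's `MobiusVStrace` theorem (their §8 window:
`Σ μ(ax²+bxy+cy²) e(h x̄/y)` summed trivially over `y`). CONJECTURE-grade; `h ≠ 0` keeps it
Siegel-robust (see card). -/
def TwistedPowerChowlaSquares : Prop :=
  ∃ α : ℝ, 0 < α ∧ ∃ θ : ℝ, 0 < θ ∧ ∃ C : ℝ, ∀ (s R : ℕ) (h : ℤ), 1 ≤ s → s ≤ R ^ 2 → h ≠ 0 →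
    (|h| : ℝ) ≤ (R : ℝ) ^ θ →
      ‖∑ r ∈ (Icc 1 R).filter (fun r : ℕ => Nat.Coprime r s),
        (ArithmeticFunction.moebius (r ^ 2 + s ^ 2) : ℂ) *
          Complex.exp (2 * Real.pi * Complex.I * ((h : ℂ) * (((r : ZMod s)⁻¹).val : ℂ) / (s : ℂ)))‖
        ≤ C * (R : ℝ) ^ (1 - α)

/-- The DEEP part of the crux's sum: moduli `d > x^{1+κ}` (cofactor `e < (n²+1)/x^{1+κ} ≤ x^{1−κ}`),
with the crux's own conditions kept so that `tailSum = windowPart + deepPart` on the nose. -/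
def deepPart (η κ : ℝ) (E x : ℕ) : ℝ :=
  ∑ n ∈ Icc 1 x, ∑ d ∈ Nat.divisors (n ^ 2 + 1),
    (if (x : ℝ) ^ (1 - η) < (d : ℝ) ∧ E * d < n ^ 2 + 1 ∧ (x : ℝ) ^ (1 + κ) < (d : ℝ)
      then mulog d else 0)

/-- The WINDOW part: moduli `x^{1−η} < d ≤ x^{1+κ}` (lower log-window, balanced window and the power
window up to `x^{1+κ}` in one piece). -/
def windowPart (η κ : ℝ) (E x : ℕ) : ℝ :=
  ∑ n ∈ Icc 1 x, ∑ d ∈ Nat.divisors (n ^ 2 + 1),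
    (if (x : ℝ) ^ (1 - η) < (d : ℝ) ∧ E * d < n ^ 2 + 1 ∧ (d : ℝ) ≤ (x : ℝ) ^ (1 + κ)
      then mulog d else 0)

/-- Bookkeeping (provable now, S): the crux's sum splits exactly. -/
def TailSplit : Prop :=
  ∀ (η κ : ℝ) (E x : ℕ), tailSum η E x = windowPart η κ E x + deepPart η κ E x

/-- FIRST LEMMA of card `ss-shadow-power-chowla` (theorem-grade glue, the "family summation"):
power saving `α` per cofactor polynomial (uniform for coefficients `e ≤ y^A`, `A = A(κ)`), summed
TRIVIALLY over the family `(e, ν)` with `Σ_{e ≤ Q} ρ(e) ≪ Q log Q`, gives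
`deepPart ≪ x^{1−ακ+o(1)}` for every `κ > 0`:  `PowerChowlaDisc4 → ∀ κ η E, deepPart = o(x)`. [L] -/
def LevelRangeFromPower : Prop :=
  PowerChowlaDisc4 → ∀ (κ η : ℝ) (E : ℕ), 0 < κ → 0 < η → η < 1 →
    (fun x : ℕ => deepPart η κ E x) =o[atTop] fun x : ℕ => (x : ℝ)

/-- Second glue stub (theorem-grade, the ℤ-shadow of SS §8 "d < k < (1+ε)d"): exact sawtooth
identity for `#{n ≤ x : n ≡ ν (d)} − x/d`, Vaaler's trigonometric approximation at `H = x^{κ+ε}`,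
Gauss's parametrisation `d = r² + s²`, `ν/d ≡ s̄/r − s/(rd)`, reciprocity `s̄/r ≡ −r̄/s + 1/(rs)`,
Hooley's UNtwisted power saving for `Σ_{d≤D} ρ_h(d)` (majorant terms), `RootMainTerms` for the main
terms, and the twisted hypothesis summed trivially over `s ≤ √(2D)`: window `≪ x^{(1+κ)(1−α/2)+o(1)}`,
`o(x)` for `κ < α/(2−α)`.  `TwistedPowerChowlaSquares → RootMainTerms → ∃ κ > 0, ∀ η E, windowPart = o(x)`. [XL] -/
def WindowFromTwisted : Prop :=
  TwistedPowerChowlaSquares → Summit.Parity.BatemanHorn.Theses.GaussianFractions.RootMainTerms →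
    ∃ κ : ℝ, 0 < κ ∧ ∀ (η : ℝ) (E : ℕ), 0 < η → η < 1 →
      (fun x : ℕ => windowPart η κ E x) =o[atTop] fun x : ℕ => (x : ℝ)

/-- Composition shape of card 1's line: the two power hypotheses + main terms ⟹ the crux, via
`TailSplit`, `WindowFromTwisted` (gives κ), `LevelRangeFromPower` (at that κ), `IsLittleO.add`, and
`CruxViaTailSum` with ANY admissible η and E := 0-or-anything (the line proves the tail bound for every
`E`, hence also `GaussianFractions.QuadraticMobiusTail`, stmt-Parity-13616). -/
def SSShadowLine : Prop :=
  PowerChowlaDisc4 → TwistedPowerChowlaSquares →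
  Summit.Parity.BatemanHorn.Theses.GaussianFractions.RootMainTerms →
  GaussianTailLargeCofactor'

end

end Summit.Parity.BatemanHorn.Cruxes.GaussianTailLargeCofactor.SketchK1
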